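import Literature.NumberTheory.Automorphic.QuaternionSubidealCount
import Literature.NumberTheory.Automorphic.BrandtModuleProofs
import Literature.NumberTheory.Automorphic.BrandtModuleLocal
import HarnessLib

/-!
# The number of integral invertible right ideals of norm `n` is multiplicative, with local
# factors the principal-ideal counts of the localisations

Topic `NumberTheory/Automorphic`; theorems only (no definition, no named fact, no instance).
For a `ℤ`-order `O` in a division quaternion algebra `B` over `ℚ`, an invertible right `O`-ideal
`I` and `n ≥ 1`, let `N(I, n)` be the number of invertible right `O`-ideals `M ⊆ I` of index
`[I : M] = n²` (reduced norm `n N(I)`), and for a prime `p` let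
`a_p(k) = #{z O₍ₚ₎ ⊆ O₍ₚ₎ : [O₍ₚ₎ : z O₍ₚ₎] = p^{2k}}` be the number of principal right ideals
of the localisation `O₍ₚ₎` of index `p^{2k}`. Then

  `N(I, n) = ∏_{p^k ∥ n} a_p(k)`   (`card_subideals_eq_prod_primeFactors`),

independently of `I`; in particular the arithmetic function `a(n) = N(O, n)` counting the
integral invertible right `O`-ideals of norm `n` satisfies `a(1) = 1`, `a(mn) = a(m) a(n)` for
`gcd(m, n) = 1` and `a(p^k) = a_p(k)` (`card_integralIdeals_one`,
`card_integralIdeals_mul_of_coprime`, `card_integralIdeals_prime_pow`). This is the Euler product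
of the zeta function of the order, `ζ_O(s) = ∑_{M ⊆ O} N(M)^{-2s} = ∏_p ζ_{O_p}(s)` (Vignéras,
LNM 800, Ch. III §5 exercice 5.8 (c) "`P(A) P(B) = P(AB)` si `(A, B) = 1`" summed over a column;
Voight, *Quaternion Algebras*, (26.3.13), Lemma 26.3.4, §26.4), assembled from the tree's

* `subidealCount_mul_of_coprime` (`BrandtModuleProofs.lean`) — unique factorisation through the
  intermediate ideal of coprime index: `T_I(mn)_k = ∑_j T_I(m)_j T_{I_j}(n)_k`;
* `card_subideals_eq_card_localPrincipal` (`QuaternionSubidealCount.lean`) — Kaplansky and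
  gluing: `#{M ⊆ I : [I : M] = p^j} = #{z O₍ₚ₎ : [O₍ₚ₎ : z O₍ₚ₎] = p^j}`;

by strong induction on `n` (split off `p^k ∥ n` for the least prime `p ∣ n`). It is the
arithmetic half of Eichler's lattice-point method for the covolume of the unit group of an
Eichler order in an indefinite quaternion algebra over `ℚ`
(`Literature.NumberTheory.Automorphic.ShimuraCurveData.volume_fd_eq`), and of his mass formula.

## References

* M.-F. Vignéras, *Arithmétique des algèbres de quaternions*, LNM 800 (1980), Ch. III §5
  exercice 5.8 [VignerasLNM800].
* J. Voight, *Quaternion Algebras*, GTM 288 (2021), Lemma 26.3.4, (26.3.13), §26.4 [Voight2021].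
-/

open Finset
open scoped Pointwise

universe u

namespace Literature.NumberTheory.Automorphic

variable {B : Type u} [Ring B] [Algebra ℚ B] [IsQuaternionAlgebra ℚ B]

/-! ### Summing the Brandt counts over the classes -/

omit [IsQuaternionAlgebra ℚ B] in
/-- **The number of invertible sub-ideals of index `n²` is the column sum of the Brandt counts**:
`#{M ⊆ I : [I : M] = n²} = ∑_{k ∈ Cls O} #{M ⊆ I : [I : M] = n², [M] = k}`. [folklore] -/
theorem card_subideals_eq_sum_subidealCount {O : Submodule ℤ B} [Fintype (RightIdealClass O)]
    {I : Submodule ℤ B} (hI : IsInvertibleRightIdeal O I) {n : ℕ} (hn : n ≠ 0) :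
    Nat.card {M : invertibleRightIdeals O // (M : Submodule ℤ B) ≤ I ∧
        (M : Submodule ℤ B).toAddSubgroup.relIndex I.toAddSubgroup = n ^ 2} =
      ∑ k, subidealCount O I n k := by
  classical
  haveI : IsAddTorsionFree B := isAddTorsionFree_of_charZero_module ℚ B
  set T := {M : invertibleRightIdeals O // (M : Submodule ℤ B) ≤ I ∧
    (M : Submodule ℤ B).toAddSubgroup.relIndex I.toAddSubgroup = n ^ 2} with hT
  let f : T → RightIdealClass O := fun M => RightIdealClass.mk M.1
  haveI hfin : ∀ k, Finite {M : T // f M = k} := fun k => by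
    haveI : Finite T := by
      have h := finite_subideals (O := O) hI.isFullLattice.1 (pow_ne_zero 2 hn) (fun _ => True)
      exact Finite.of_injective (fun M : T => (⟨M.1, M.2.1, M.2.2, trivial⟩ :
        {M : invertibleRightIdeals O // (M : Submodule ℤ B) ≤ I ∧
          (M : Submodule ℤ B).toAddSubgroup.relIndex I.toAddSubgroup = n ^ 2 ∧ True}))
        (fun M M' h => Subtype.ext (congrArg (fun x => x.1) h))
    infer_instance
  rw [← Nat.card_congr (Equiv.sigmaFiberEquiv f), Nat.card_sigma]
  refine Finset.sum_congr rfl fun k _ => ?_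
  rw [subidealCount]
  exact Nat.card_congr
    { toFun := fun M => ⟨M.1.1, M.1.2.1, M.1.2.2, M.2⟩
      invFun := fun M => ⟨⟨M.1, M.2.1, M.2.2.1⟩, M.2.2.2⟩
      left_inv := fun M => rfl
      right_inv := fun M => rfl }

/-! ### The local factorisation -/

section Factorization

variable (hdiv : ∀ x : B, x ≠ 0 → IsUnit x) {O : Submodule ℤ B} (hO : IsZOrder O)
include hdiv hO

/-- **`N(I, n) = ∏_{p^k ∥ n} a_p(k)`**: the number of invertible right `O`-ideals `M ⊆ I` of
index `n²` (`n ≥ 1`) inside an invertible right ideal `I` of a `ℤ`-order `O` of a division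
quaternion algebra over `ℚ` is the product over the primes `p ∣ n`, `p^k ∥ n`, of the number of
principal right ideals of `O₍ₚ₎` of index `p^{2k}`; in particular it does not depend on `I`.
(Strong induction on `n`: `subidealCount_mul_of_coprime` splits off `p^k ∥ n`, and
`card_subideals_eq_card_localPrincipal` evaluates the `p`-primary count.)
[cite: VignerasLNM800, Ch. III §5 exercice 5.8 (c)] [cite: Voight2021, Lemma 26.3.4, (26.3.13)] -/
theorem card_subideals_eq_prod_primeFactors {n : ℕ} (hn : n ≠ 0) {I : Submodule ℤ B}
    (hI : IsInvertibleRightIdeal O I) :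
    Nat.card {M : invertibleRightIdeals O // (M : Submodule ℤ B) ≤ I ∧
        (M : Submodule ℤ B).toAddSubgroup.relIndex I.toAddSubgroup = n ^ 2} =
      ∏ p ∈ n.primeFactors, Nat.card {N : Submodule ℤ B //
        (∃ z : Bˣ, (z : B) ∈ localAt p O ∧ N = z • localAt p O) ∧
          N.toAddSubgroup.relIndex (localAt p O).toAddSubgroup = p ^ (2 * n.factorization p)} := by
  classical
  haveI : IsAddTorsionFree B := isAddTorsionFree_of_charZero_module ℚ B
  haveI : Fintype (RightIdealClass O) := @Fintype.ofFinite _ (RightIdealClass.finite hO)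
  -- strong induction on `n`, for all `I` at once
  induction n using Nat.strong_induction_on generalizing I with
  | _ n ih =>
  rcases Nat.lt_or_ge 1 n with h1 | h1
  · -- `n > 1`: split off the least prime
    set p := n.minFac with hp
    have hpp : p.Prime := Nat.minFac_prime h1.ne'
    haveI : Fact p.Prime := ⟨hpp⟩
    set k := n.factorization p with hk
    set n' := n / p ^ k with hn'
    have hpn : p ∣ n := Nat.minFac_dvd n
    have hk0 : 0 < k := hpp.factorization_pos_of_dvd hn hpn
    have hdvd : p ^ k ∣ n := Nat.ordProj_dvd n p
    have hn_eq : n = p ^ k * n' := by rw [hn', Nat.mul_div_cancel' hdvd]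
    have hn'0 : n' ≠ 0 := by
      intro h; rw [h, mul_zero] at hn_eq; exact hn hn_eq
    have hcop : Nat.Coprime (p ^ k) n' := (Nat.coprime_ordCompl hpp hn).pow_left k
    have hn'lt : n' < n := by
      rw [hn_eq]
      refine lt_mul_of_one_lt_left (Nat.pos_of_ne_zero hn'0) ?_
      exact one_lt_pow₀ hpp.one_lt hk0.ne'
    -- the count splits: `N(I, p^k n') = (∑_j T_I(p^k)_j) · N(·, n')`
    have hsplit : Nat.card {M : invertibleRightIdeals O // (M : Submodule ℤ B) ≤ I ∧
        (M : Submodule ℤ B).toAddSubgroup.relIndex I.toAddSubgroup = n ^ 2} =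
        (∑ j, subidealCount O I (p ^ k) j) *
          ∏ q ∈ n'.primeFactors, Nat.card {N : Submodule ℤ B //
            (∃ z : Bˣ, (z : B) ∈ localAt q O ∧ N = z • localAt q O) ∧
              N.toAddSubgroup.relIndex (localAt q O).toAddSubgroup = q ^ (2 * n'.factorization q)} := by
      rw [card_subideals_eq_sum_subidealCount hI hn]
      have hrw : ∀ k', subidealCount O I n k' = subidealCount O I (p ^ k * n') k' := by
        intro k'; rw [← hn_eq]
      simp_rw [hrw, subidealCount_mul_of_coprime hI (pow_ne_zero k hpp.ne_zero) hn'0 hcop]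
      rw [Finset.sum_comm, Finset.sum_mul]
      refine Finset.sum_congr rfl fun j _ => ?_
      rw [← Finset.mul_sum, ← card_subideals_eq_sum_subidealCount
        (RightIdealClass.isInvertibleRightIdeal_rep j) hn'0,
        ih n' hn'lt hn'0 (RightIdealClass.isInvertibleRightIdeal_rep j)]
    -- the `p`-primary count
    have hpcount : ∑ j, subidealCount O I (p ^ k) j = Nat.card {N : Submodule ℤ B //
        (∃ z : Bˣ, (z : B) ∈ localAt p O ∧ N = z • localAt p O) ∧
          N.toAddSubgroup.relIndex (localAt p O).toAddSubgroup = p ^ (2 * k)} := by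
      rw [← card_subideals_eq_sum_subidealCount hI (pow_ne_zero k hpp.ne_zero),
        ← card_subideals_eq_card_localPrincipal hdiv hO hI (2 * k)]
      have : (p ^ k) ^ 2 = p ^ (2 * k) := by rw [← pow_mul, mul_comm]
      simp_rw [this]
    rw [hsplit, hpcount]
    -- bookkeeping of prime factorisations
    have hpn' : p ∉ n'.primeFactors := by
      intro hq
      have hpdvd : p ∣ n' := Nat.dvd_of_mem_primeFactors hq
      have h1' : p = 1 := Nat.Coprime.eq_one_of_dvd (hcop.coprime_dvd_left (dvd_pow_self p hk0.ne')) hpdvd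
      exact hpp.one_lt.ne' h1'
    have hpf : n.primeFactors = insert p n'.primeFactors := by
      rw [hn_eq, Nat.primeFactors_mul (pow_ne_zero k hpp.ne_zero) hn'0,
        Nat.primeFactors_prime_pow hk0.ne' hpp, Finset.insert_eq]
    rw [hpf, Finset.prod_insert hpn']
    have hfacp : n.factorization p = k := rfl
    rw [hfacp]
    congr 1
    refine Finset.prod_congr rfl fun q hq => ?_
    have hqp : q ≠ p := fun h => hpn' (h ▸ hq)
    have hfac : n.factorization q = n'.factorization q := by
      rw [hn_eq, Nat.factorization_mul (pow_ne_zero k hpp.ne_zero) hn'0, Finsupp.add_apply,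
        hpp.factorization_pow, Finsupp.single_eq_of_ne hqp, zero_add]
    rw [hfac]
  · -- `n = 1`
    interval_cases n
    · exact absurd rfl hn
    · rw [Nat.primeFactors_one, Finset.prod_empty]
      rw [Nat.card_eq_one_iff_exists]
      refine ⟨⟨⟨I, hI⟩, le_rfl, by rw [one_pow, AddSubgroup.relIndex_self]⟩, fun M => ?_⟩
      have hle : (M.1 : Submodule ℤ B) ≤ I := M.2.1
      have hidx : (M.1 : Submodule ℤ B).toAddSubgroup.relIndex I.toAddSubgroup = 1 := by
        simpa using M.2.2
      rw [AddSubgroup.relIndex_eq_one] at hidx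
      apply Subtype.ext; apply Subtype.ext
      exact le_antisymm hle (fun x hx => hidx hx)

/-- **`a(1) = 1`**: the only invertible right `O`-ideal `M ⊆ O` of index `1` is `O`. [folklore] -/
theorem card_integralIdeals_one :
    Nat.card {M : invertibleRightIdeals O // (M : Submodule ℤ B) ≤ O ∧
        (M : Submodule ℤ B).toAddSubgroup.relIndex O.toAddSubgroup = 1 ^ 2} = 1 := by
  rw [card_subideals_eq_prod_primeFactors hdiv hO one_ne_zero hO.isInvertibleRightIdeal_self,
    Nat.primeFactors_one, Finset.prod_empty]

/-- **`a(p^k) = a_p(k)`**: the integral invertible right `O`-ideals of norm `p^k` are counted by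
the principal right ideals of `O₍ₚ₎` of index `p^{2k}`. [cite: Voight2021, §26.4] -/
theorem card_integralIdeals_prime_pow {p : ℕ} (hp : p.Prime) (k : ℕ) :
    Nat.card {M : invertibleRightIdeals O // (M : Submodule ℤ B) ≤ O ∧
        (M : Submodule ℤ B).toAddSubgroup.relIndex O.toAddSubgroup = (p ^ k) ^ 2} =
      Nat.card {N : Submodule ℤ B // (∃ z : Bˣ, (z : B) ∈ localAt p O ∧ N = z • localAt p O) ∧
        N.toAddSubgroup.relIndex (localAt p O).toAddSubgroup = p ^ (2 * k)} := by
  haveI : Fact p.Prime := ⟨hp⟩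
  rw [← card_subideals_eq_card_localPrincipal hdiv hO hO.isInvertibleRightIdeal_self (2 * k)]
  have : (p ^ k) ^ 2 = p ^ (2 * k) := by rw [← pow_mul, mul_comm]
  simp_rw [this]

/-- **`a(mn) = a(m) a(n)` for coprime `m, n`**: the number of integral invertible right `O`-ideals
of norm `n` is a multiplicative arithmetic function (Eichler; Vignéras III §5 ex. 5.8 (c)). The
degenerate cases `m = 0` or `n = 0` (then the other is `1`) hold trivially. [cite: VignerasLNM800, Ch. III §5 exercice 5.8 (c)] -/
theorem card_integralIdeals_mul_of_coprime (m n : ℕ) (hmn : m.Coprime n) :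
    Nat.card {M : invertibleRightIdeals O // (M : Submodule ℤ B) ≤ O ∧
        (M : Submodule ℤ B).toAddSubgroup.relIndex O.toAddSubgroup = (m * n) ^ 2} =
      Nat.card {M : invertibleRightIdeals O // (M : Submodule ℤ B) ≤ O ∧
          (M : Submodule ℤ B).toAddSubgroup.relIndex O.toAddSubgroup = m ^ 2} *
        Nat.card {M : invertibleRightIdeals O // (M : Submodule ℤ B) ≤ O ∧
          (M : Submodule ℤ B).toAddSubgroup.relIndex O.toAddSubgroup = n ^ 2} := by
  rcases Nat.eq_zero_or_pos m with rfl | hm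
  · have h1 : n = 1 := by simpa using hmn
    subst h1
    rw [zero_mul, card_integralIdeals_one hdiv hO, mul_one]
  rcases Nat.eq_zero_or_pos n with rfl | hn
  · have h1 : m = 1 := by simpa using hmn
    subst h1
    rw [mul_zero, card_integralIdeals_one hdiv hO, one_mul]
  have hO1 := hO.isInvertibleRightIdeal_self
  rw [card_subideals_eq_prod_primeFactors hdiv hO (mul_ne_zero hm.ne' hn.ne') hO1,
    card_subideals_eq_prod_primeFactors hdiv hO hm.ne' hO1,
    card_subideals_eq_prod_primeFactors hdiv hO hn.ne' hO1,
    Nat.primeFactors_mul hm.ne' hn.ne', Finset.prod_union hmn.disjoint_primeFactors]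
  congr 1
  · refine Finset.prod_congr rfl fun q hq => ?_
    have hqm : q ∣ m := Nat.dvd_of_mem_primeFactors hq
    have hq1 : 1 < q := (Nat.prime_of_mem_primeFactors hq).one_lt
    have hqn : ¬ q ∣ n := fun h =>
      hq1.ne' (Nat.Coprime.eq_one_of_dvd (hmn.coprime_dvd_left hqm) h)
    rw [Nat.factorization_mul hm.ne' hn.ne', Finsupp.add_apply,
      Nat.factorization_eq_zero_of_not_dvd hqn, add_zero]
  · refine Finset.prod_congr rfl fun q hq => ?_
    have hqn : q ∣ n := Nat.dvd_of_mem_primeFactors hq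
    have hq1 : 1 < q := (Nat.prime_of_mem_primeFactors hq).one_lt
    have hqm : ¬ q ∣ m := fun h =>
      hq1.ne' (Nat.Coprime.eq_one_of_dvd (hmn.symm.coprime_dvd_left hqn) h)
    rw [Nat.factorization_mul hm.ne' hn.ne', Finsupp.add_apply,
      Nat.factorization_eq_zero_of_not_dvd hqm, zero_add]

end Factorization

end Literature.NumberTheory.Automorphic
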